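import Summits.QuantumFields.BalabanUV.T4Continuum.Support.NE3EnergyRateWSupRoutePi
import Summits.QuantumFields.BalabanUV.T4Continuum.Support.NE3ClassRadiusFamily
import HarnessLib

/-!
# T⁴ programme, node NE3 — route Π, file 6c: THE END OF ROUTE Π WITH THE CLASS FAMILY `hsmall` AND `0 ≤ CP` DISCHARGED BY NE3-R2's
# `NE3ClassRadiusFamily` — two k-free lines in `ε` replace the family, the constant's sign is a theorem

NE3 (node U1b), row NE3 OWNER `b2b-balaban-t4-ne3-p1` (gen 26; ONLINE journal l.24333: «`levelSmall_family` (discharging `hsmall`) and `CPLine_nonneg` (discharging `hCP`) are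
consumed BY NAME in this gen's END»).  Inputs BY NAME: file 6bγ `NE3EnergyRateWSupRoutePi.ne3EnergyRateWSup_sfClass_routePi` (the END of record of route Π), row
NE3-R2's K-g12-1 `NE3ClassRadiusFamily.levelSmall_family` ∕ `CPLine_nonneg` (owner NE3-R2 gen 12, p243801).

WHAT.  **`ne3EnergyRateWSup_sfClass_routePi_lines`** = the END of record with `hsmall : ∀ j, LevelSmall d L (j+1) (ε∕(L^{j+2})²)` REPLACED by the two k-free lines
`16·(14464(d+1)²(d+4)²)·ε ≤ 3` and `2·twoLevelSmall d L·ε ≤ L²`, and `hCP : 0 ≤ CPLine …` REMOVED (a theorem for `0 < εc`, `0 ≤ θK`).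

HONEST FRAMING.  A two-line composition; every other hypothesis of the END of record stands as displayed there (the residual slice representative leaf, the weight
with its local quadratic letter, the right-inverse letters, the currencies, the K-road and budget lines); T-E_w♯ and NE3 are NOT proved; spine PROVED 0∕9; finite
T⁴ rung (B)+1 — NOT infinite volume, NOT mass gap, NOT `BetaPertH`, NOT Clay.  PLACEMENT: `Summits/QuantumFields/BalabanUV/`.  HONEST DEPENDENCY: continuum YM on
T⁴ ⇐ BetaPertH ∧ nine spine estimates (0/9 proved); BetaPertH ⇐ (D1) ∧ (D4) ∧ CAP+tail; G-an2-4 gates asym, D1 and NE2/3/4.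
-/

set_option autoImplicit false

open scoped BigOperators Matrix.Norms.L2Operator
open NormedSpace Finset

namespace Summit.QuantumFields.BalabanUV.T4Continuum.NE3EnergyRateWSupRoutePiLines

open Set
open Literature.MathematicalPhysics.QuantumFieldTheory.Balaban1983to89
open B7Prop1Explicit B7Prop2Explicit
open T4AveragingDeficitWall hiding Site Plane Plaq Bond
open T4AveragingDeficitWallBoundary (IsPeriodicCfg periodBox)
open AveragingDeficitPeriodicCounting (IsPeriodicDir)
open AveragingDeficitChartCalculus (cavg)
open AveragingDeficitTwoLevelPrep (twoLevelSmall)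
open NE3CovariantLineSumsL2 (C2sq)
open NE3CovariantLineSumsL2Tower (rho)
open MinimalActionLevels (perWin)
open MinimalActionRate (sfClass Regular)
open MinimalActionSandwich (IsMinimiser)
open NE3TangentCovariantTower (dirIter)
open NE3EnergyWeightedSupShape (NE3EnergyRateWSup)
open NE3EnergyRateWSupOfSlicePoincare (cLambda)
open NE3SlicePoincareBudgetLine (ShLine SmallYLine CPLine)
open NE3DecomposedRepOfLinearNormalPart (ResidualSliceRepT)
open NE3EnergyRateWSupRoutePi (piRad piNu piKappa1 piKappa2 ne3EnergyRateWSup_sfClass_routePi)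
open NE3ClassRadiusFamily (levelSmall_family CPLine_nonneg)

noncomputable section

variable {d : ℕ} {n : Type*} [Fintype n] [DecidableEq n]

/-- **THE END OF ROUTE Π OVER `sfClass` WITH THE CLASS FAMILY AND THE CONSTANT'S SIGN DISCHARGED** (see the module docstring and
`NE3EnergyRateWSupRoutePi.ne3EnergyRateWSup_sfClass_routePi` for the reading of every hypothesis). [folklore] -/
theorem ne3EnergyRateWSup_sfClass_routePi_lines [Nonempty n] (hd : 3 ≤ d) {L N : ℕ} [NeZero L] [NeZero N] (hL : 2 ≤ L) (hN : 1 ≤ N)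
    {ε b g : ℝ} (hb : 0 ≤ b) (hbε : b < ε) (hg : 0 < g)
    (hbs : 512 * (d + 1) * (d + 4) * (L : ℝ) ^ 2 * b ≤ 1) (hbε' : b + 226 * (8 * (d + 1) * (d + 4)) ^ 2 * b ^ 2 ≤ ε)
    -- the class family as two k-free lines (NE3-R2 K-g12-1)
    (hε1 : 16 * (14464 * ((d : ℝ) + 1) ^ 2 * ((d : ℝ) + 4) ^ 2) * ε ≤ 3) (hε2 : 2 * twoLevelSmall d L * ε ≤ (L : ℝ) ^ 2)
    -- the K-road lines of (P♮)_W
    {dom : Set (Site d → Fin d → (Matrix n n ℂ)ˣ)} {θK εc : ℝ} (hε : 0 < ε) (hεθ : ε ≤ θK) (hεc : 0 < εc)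
    (hK1 : ShLine d L (Fintype.card n) εc θK ≤ 1 / 2) (hK2 : SmallYLine d L (Fintype.card n) εc θK ≤ 1 / 2)
    (hK3 : 68 / 3 * (((d : ℝ) + 1) * ((d : ℝ) + 4)) * C2sq d L * θK ≤ rho d L / 2)
    (hK4 : 8 * d * (((d : ℝ) - 1) * θK) ^ 2
      + 2 * ((Fintype.card n : ℝ) * ((4 * (d : ℝ) ^ 2 + 272 * d * (((d : ℝ) + 1) * ((d : ℝ) + 4))) * θK) ^ 2) ≤ 1 / 2)
    -- route Π: constants, ceilings, four uniform lines
    {C₂ c₁ c₂ c₃ c₄ αh Ch αNh aNh Λ : ℝ} (hC₂ : 0 ≤ C₂) (hc₁ : 0 ≤ c₁) (hc₂ : 0 ≤ c₂) (hc₃ : 0 ≤ c₃) (hc₄ : 0 ≤ c₄)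
    (hαh0 : 0 ≤ αh) (hCh0 : 0 ≤ Ch)
    (hℓ₁ : αh ≤ 1 / 100) (hℓ₃ : αNh ≤ 1 / 2700) (hℓ₄ : 10 * (αh + 24 * αNh) ≤ 1) (hℓ₅ : 2 * (c₁ + c₂) * C₂ ^ 2 * Ch ^ 2 * αh ^ 2 ≤ 1 / 2)
    -- level, regularity and budget lines
    (hJ1 : (1 + 480 * Real.sqrt d * (αh + 24 * αNh)) ^ 2 + 48 * d * piRad ε αh αNh aNh ≤ Λ)
    (hJ2 : 112 * (d : ℝ) * piRad ε αh αNh aNh * CPLine d L (Fintype.card n) εc θK ≤ 1 / (2 * (Fintype.card n : ℝ)))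
    (hreg₁ : CPLine d L (Fintype.card n) εc θK * (Real.sqrt Λ - 1) ^ 2 ≤ 1 / 4)
    (hbudget : 2 * Λ * (2 * (1 + 4 * Real.sqrt (16 * d + 1)) * piNu d c₁ c₂ C₂ Ch αh)
        + Λ * (2 * (1 + 4 * Real.sqrt (16 * d + 1)) * piNu d c₁ c₂ C₂ Ch αh) ^ 2
        + (2 * piKappa1 d c₃ c₄ C₂ Ch ε αh αNh aNh + 912 * d * piKappa2 c₄ C₂ Ch ε αh αNh aNh) + 2 * 0
      ≤ cLambda n (CPLine d L (Fintype.card n) εc θK) Λ / 2)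
    -- the residual slice representative, the weight with its quadratic letter, the letters of the linear normal part, the currencies — per pair
    (hleaves : ∀ j : ℕ, ∀ V ∈ dom, ∀ UA UB : Site d → Fin d → (Matrix n n ℂ)ˣ,
      IsMinimiser d (sfClass d L N ε) L N (j + 1) V UA → IsMinimiser d (sfClass d L N ε) L N (j + 2) V UB →
        Regular d L N b g (j + 2) UB →
        ∃ (u : Site d → (Matrix n n ℂ)ˣ) (X₀ Nn : Site d → Fin d → Matrix n n ℂ) (α₀ : ℝ) (m : Site d → Fin d → ℝ) (C αN aN : ℝ),
          ResidualSliceRepT L N (j + 1) (cavg L UB) UA u X₀ Nn α₀ ∧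
          (∀ z κ, 0 ≤ m z κ) ∧ 0 ≤ C ∧
          ((L : ℝ) ^ (j + 1)) ^ d * ∑ z ∈ periodBox (d := d) N, ∑ κ : Fin d, m z κ ^ 2
            ≤ C ^ 2 * dirSq X₀ (periodBox (d := d) (N * L ^ (j + 1))) ∧
          (∀ z ∈ periodBox (d := d) N, ∀ κ : Fin d,
            ‖dirIter L (j + 1) (cavg L UB) X₀ z κ‖ ≤ C₂ * ((L : ℝ) ^ (j + 1) * m z κ) ^ 2) ∧
          IsPeriodicDir Nn ((N * L ^ (j + 1) : ℕ) : ℤ) ∧ 0 ≤ αN ∧ (∀ y μ, ‖Nn y μ‖ ≤ αN) ∧ 0 ≤ aN ∧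
          (∀ p ∈ perWin d (N * L ^ (j + 1)), ‖curl (cavg L UB) Nn p‖ ≤ aN) ∧
          dirSq Nn (periodBox (d := d) (N * L ^ (j + 1)))
            ≤ c₁ * (((L : ℝ) ^ (j + 1)) ^ d / ((L : ℝ) ^ (j + 1)) ^ 2) * dirSq (dirIter L (j + 1) (cavg L UB) X₀) (periodBox (d := d) N) ∧
          curlSq (cavg L UB) Nn (periodBox (d := d) (N * L ^ (j + 1)))
            ≤ c₂ * (((L : ℝ) ^ (j + 1)) ^ d / ((L : ℝ) ^ (j + 1)) ^ 4) * dirSq (dirIter L (j + 1) (cavg L UB) X₀) (periodBox (d := d) N) ∧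
          (∑ p ∈ perWin d (N * L ^ (j + 1)), ‖curl (cavg L UB) Nn p‖
            ≤ c₃ * (((L : ℝ) ^ (j + 1)) ^ d / ((L : ℝ) ^ (j + 1)) ^ 2) * dirL1 (dirIter L (j + 1) (cavg L UB) X₀) (periodBox (d := d) N)) ∧
          dirL1 Nn (periodBox (d := d) (N * L ^ (j + 1)))
            ≤ c₄ * (((L : ℝ) ^ (j + 1)) ^ d / (L : ℝ) ^ (j + 1)) * dirL1 (dirIter L (j + 1) (cavg L UB) X₀) (periodBox (d := d) N) ∧
          α₀ * (L : ℝ) ^ (j + 1) ≤ αh ∧ (∀ z κ, m z κ * (L : ℝ) ^ (j + 1) ≤ αh) ∧ C ≤ Ch ∧ αN * (L : ℝ) ^ (j + 1) ≤ αNh ∧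
          aN * ((L : ℝ) ^ (j + 1)) ^ 2 ≤ aNh) :
    NE3EnergyRateWSup d (sfClass d L N ε) L N b g
      ((1 + (piNu d c₁ c₂ C₂ Ch αh + 23 * Real.sqrt 2 * Real.sqrt (16 * d + 1) * (1 + piNu d c₁ c₂ C₂ Ch αh)))
        * (4 / cLambda n (CPLine d L (Fintype.card n) εc θK) Λ)
        * (Real.sqrt ((L : ℝ) ^ (d - 2))
            + (Real.sqrt ((L : ℝ) ^ (d - 2)) * Real.sqrt (8 * Fintype.card (T4AveragingDeficitWall.Plane d))
                * (128 * (d * (L : ℝ) ^ 2))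
              + 2 * (2048 * ((d : ℝ) + 4) ^ 2 * (L : ℝ) ^ 2 * Real.sqrt (d * (L : ℝ) ^ d))) * b
            + b ^ 2 * (2 * (L : ℝ) ^ (d - 1) + 2 * (8 * d * (L : ℝ) ^ d)) * Real.sqrt (d / (g * (L : ℝ) ^ (d + 2)))))
      ((Real.sqrt Λ - 1) / (24 * Real.sqrt d)) dom :=
  ne3EnergyRateWSup_sfClass_routePi hd hL hN hb hbε hg hbs hbε' (levelSmall_family hL hε.le hε1 hε2) hε hεθ hεc hK1 hK2 hK3 hK4
    hC₂ hc₁ hc₂ hc₃ hc₄ hαh0 hCh0 hℓ₁ hℓ₃ hℓ₄ hℓ₅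
    (CPLine_nonneg (by omega) (Nat.cast_nonneg _) hεc.le (hε.le.trans hεθ)) hJ1 hJ2 hreg₁ hbudget hleaves

end

end Summit.QuantumFields.BalabanUV.T4Continuum.NE3EnergyRateWSupRoutePiLines
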